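import Literature.Analysis.FluidPDE.ConfinedHardSphereFlow
import Literature.Analysis.FluidPDE.HardSphereDynamicsProofs
import HarnessLib

/-!
# Structure of a confined hard-sphere trajectory: one-sided limits, time shifts, time reversal

Properties of the predicate `IsConfinedHardSphereTrajectory G W ε N γ` of
`Literature.Analysis.FluidPDE.ConfinedHardSphereFlow` (hard spheres among fixed specular
obstacles; Cercignani–Illner–Pulvirenti 1994 §4.2) that only use its clauses — the confined
analogue of the trajectory part of `Literature.Analysis.FluidPDE.HardSphereDynamicsProofs`, used
by the restart / group-property layer of the proof of
`ConfinedHardSphereFlow.nonempty_torus_balls`: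

* event-free one-sided neighbourhoods of every time (`exists_Ioo_left_free`,
  `exists_Ioo_right_free`), free flight on `[s, t)` for `(s, t)` event-free, hence left limits
  (`tendsto_nhdsLT`, `leftLim_eq_freeFlight`, `tendsto_leftLim`), right-continuity
  (`tendsto_nhdsGT`), the limits of `leftLim γ`, positions of the left limit, the two jump
  clauses with the left limit made explicit (`eq_collidePair_leftLim`, `eq_reflectWall_leftLim`);
* invariance under time shifts (`comp_add_right`);
* **reversibility** (CIP 1994 §4.2 (2.3)): the time reversal `t ↦ flipVel (leftLim γ (-t))`
  (`FluidPDE.timeReverse`) of a confined trajectory is a confined trajectory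
  (`IsConfinedHardSphereTrajectory.timeReverse`), for a Hausdorff position space and continuous
  translations: both jump maps commute with the velocity flip, are involutions, and exchange
  incoming and outgoing configurations.

## References

* C. Cercignani, R. Illner, M. Pulvirenti, *The Mathematical Theory of Dilute Gases*, Springer
  (1994), §4.2 pp. 64–65, eq. (2.2), (2.3).
-/

open Set Filter Function
open scoped Topology

namespace Literature.Analysis.FluidPDE

noncomputable section

section Kinetic

variable {d : Type*} [Fintype d] {X : Type*} {N : ℕ} {ι : Type*}

/-! ## Predicates that only see positions -/

/-- Membership in the confined domain only depends on the positions. [folklore] -/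
theorem mem_confinedDomain_congr_fst {G : Geometry d X} {W : ι → Wall d X} {ε : ℝ}
    {z z' : Config N d X} (h : ∀ i, (z i).1 = (z' i).1) :
    z ∈ confinedDomain G W N ε ↔ z' ∈ confinedDomain G W N ε := by
  simp only [mem_confinedDomain, mem_hardSphereDomain_congr_fst h, h]

/-- Membership in a wall contact set only depends on the positions. [folklore] -/
theorem mem_wallContactSet_congr_fst {G : Geometry d X} {W : ι → Wall d X} {ε : ℝ} {i : Fin N}
    {k : ι} {z z' : Config N d X} (h : ∀ i, (z i).1 = (z' i).1) :
    z ∈ wallContactSet G W N ε i k ↔ z' ∈ wallContactSet G W N ε i k := by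
  rw [mem_wallContactSet, mem_wallContactSet, mem_confinedDomain_congr_fst h, h i]

/-- The velocity flip preserves wall contact sets. [folklore] -/
@[simp]
theorem flipVel_mem_wallContactSet_iff {G : Geometry d X} {W : ι → Wall d X} {ε : ℝ} {i : Fin N}
    {k : ι} (z : Config N d X) : flipVel z ∈ wallContactSet G W N ε i k ↔ z ∈ wallContactSet G W N ε i k :=
  mem_wallContactSet_congr_fst fun _ => rfl

/-- A wall reflection does not change the positions, hence not pair contacts. [folklore] -/
theorem reflectWall_mem_contactSet_iff {G : Geometry d X} {ε : ℝ} {Wk : Wall d X} {i : Fin N}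
    {z : Config N d X} {i' j' : Fin N} :
    reflectWall Wk i z ∈ contactSet G N ε i' j' ↔ z ∈ contactSet G N ε i' j' :=
  mem_contactSet_congr_fst fun k => reflectWall_apply_fst Wk i z k

/-- The velocity flip exchanges wall-incoming and wall-outgoing. [folklore] -/
theorem isWallIncoming_flipVel_iff (Wk : Wall d X) (z : Config N d X) (i : Fin N) :
    IsWallIncoming Wk (flipVel z) i ↔ IsWallOutgoing Wk z i := by
  simp only [IsWallIncoming, IsWallOutgoing, flipVel_apply, inner_neg_left, neg_neg_iff_pos]

/-- The velocity flip exchanges wall-outgoing and wall-incoming. [folklore] -/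
theorem isWallOutgoing_flipVel_iff (Wk : Wall d X) (z : Config N d X) (i : Fin N) :
    IsWallOutgoing Wk (flipVel z) i ↔ IsWallIncoming Wk z i := by
  rw [← isWallIncoming_flipVel_iff, flipVel_flipVel]

/-- The velocity flip preserves the confined domain. [folklore] -/
@[simp]
theorem flipVel_mem_confinedDomain_iff {G : Geometry d X} {W : ι → Wall d X} {ε : ℝ} {z : Config N d X} :
    flipVel z ∈ confinedDomain G W N ε ↔ z ∈ confinedDomain G W N ε :=
  mem_confinedDomain_congr_fst fun _ => rfl

/-- Event times of two curves with the same positions coincide. [folklore] -/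
theorem mem_eventTimes_congr_fst {G : Geometry d X} {W : ι → Wall d X} {ε : ℝ}
    {γ γ' : ℝ → Config N d X} {t : ℝ} (h : ∀ i, (γ t i).1 = (γ' t i).1) :
    t ∈ eventTimes G W ε γ ↔ t ∈ eventTimes G W ε γ' := by
  simp only [mem_eventTimes, mem_collisionTimes, mem_wallCollisionTimes, mem_contactSet_congr_fst h,
    mem_wallContactSet_congr_fst h]

/-! ## Structure of a confined hard-sphere trajectory -/

namespace IsConfinedHardSphereTrajectory

variable [TopologicalSpace X] {G : Geometry d X} {W : ι → Wall d X} {ε : ℝ} {γ : ℝ → Config N d X}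

/-- Every time has an event-free open interval immediately to its left. [folklore] -/
theorem exists_Ioo_left_free (h : IsConfinedHardSphereTrajectory G W ε N γ) (t : ℝ) :
    ∃ s < t, ∀ τ ∈ Ioo s t, τ ∉ eventTimes G W ε γ := by
  classical
  set F : Finset ℝ := insert (t - 1) (((h.locFinite (t - 1) t).toFinset).filter fun x => x < t) with hF
  have hne : F.Nonempty := ⟨t - 1, Finset.mem_insert_self _ _⟩
  refine ⟨F.max' hne, ?_, ?_⟩
  · rw [Finset.max'_lt_iff]
    intro y hy
    rcases Finset.mem_insert.1 hy with rfl | hy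
    · linarith
    · exact (Finset.mem_filter.1 hy).2
  · intro τ hτ hcol
    have hτF : τ ∈ F := by
      refine Finset.mem_insert_of_mem (Finset.mem_filter.2 ⟨?_, hτ.2⟩)
      rw [Set.Finite.mem_toFinset]
      have hlow : t - 1 ≤ F.max' hne := Finset.le_max' F (t - 1) (Finset.mem_insert_self _ _)
      exact ⟨hcol, by linarith [hτ.1], hτ.2.le⟩
    exact (not_lt.2 (Finset.le_max' F τ hτF)) hτ.1

/-- Every time has an event-free open interval immediately to its right. [folklore] -/
theorem exists_Ioo_right_free (h : IsConfinedHardSphereTrajectory G W ε N γ) (t : ℝ) :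
    ∃ u > t, ∀ τ ∈ Ioo t u, τ ∉ eventTimes G W ε γ := by
  classical
  set F : Finset ℝ := insert (t + 1) (((h.locFinite t (t + 1)).toFinset).filter fun x => t < x) with hF
  have hne : F.Nonempty := ⟨t + 1, Finset.mem_insert_self _ _⟩
  refine ⟨F.min' hne, ?_, ?_⟩
  · rw [gt_iff_lt, Finset.lt_min'_iff]
    intro y hy
    rcases Finset.mem_insert.1 hy with rfl | hy
    · linarith
    · exact (Finset.mem_filter.1 hy).2
  · intro τ hτ hcol
    have hτF : τ ∈ F := by
      refine Finset.mem_insert_of_mem (Finset.mem_filter.2 ⟨?_, hτ.1⟩)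
      rw [Set.Finite.mem_toFinset]
      have hup : F.min' hne ≤ t + 1 := Finset.min'_le F (t + 1) (Finset.mem_insert_self _ _)
      exact ⟨hcol, hτ.1.le, by linarith [hτ.2]⟩
    exact (not_lt.2 (Finset.min'_le F τ hτF)) hτ.2

/-- On `[s, t)` with `(s, t)` event-free, the trajectory is free flight from `γ s`. [folklore] -/
theorem eq_freeFlight_of_Ioo_free (h : IsConfinedHardSphereTrajectory G W ε N γ) {s t τ : ℝ}
    (hfree : ∀ σ ∈ Ioo s t, σ ∉ eventTimes G W ε γ) (hτ : τ ∈ Ico s t) :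
    γ τ = freeFlight G (τ - s) (γ s) :=
  h.free s τ hτ.1 fun σ hσ => hfree σ ⟨hσ.1, hσ.2.trans_lt hτ.2⟩

/-- Left limits: if `(s, t)` is event-free then `γ τ → S_{t-s} (γ s)` as `τ ↑ t`. [folklore] -/
theorem tendsto_nhdsLT (h : IsConfinedHardSphereTrajectory G W ε N γ) (hG : ∀ x : X, Continuous (G.translate x))
    {s t : ℝ} (hst : s < t) (hfree : ∀ σ ∈ Ioo s t, σ ∉ eventTimes G W ε γ) :
    Tendsto γ (𝓝[<] t) (𝓝 (freeFlight G (t - s) (γ s))) := by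
  have hc : Continuous fun τ : ℝ => freeFlight G (τ - s) (γ s) := by
    have hff := continuous_freeFlight_of_continuous_translate hG (γ s)
    fun_prop
  refine ((hc.tendsto t).mono_left nhdsWithin_le_nhds).congr' ?_
  filter_upwards [Ioo_mem_nhdsLT hst] with τ hτ
  exact (h.eq_freeFlight_of_Ioo_free hfree ⟨hτ.1.le, hτ.2⟩).symm

/-- The left limit at `t` is the free-flight value from any `s < t` with `(s, t)` event-free. [folklore] -/
theorem leftLim_eq_freeFlight [T2Space X] (h : IsConfinedHardSphereTrajectory G W ε N γ)
    (hG : ∀ x : X, Continuous (G.translate x)) {s t : ℝ} (hst : s < t)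
    (hfree : ∀ σ ∈ Ioo s t, σ ∉ eventTimes G W ε γ) : leftLim γ t = freeFlight G (t - s) (γ s) :=
  leftLim_eq_of_tendsto (h.tendsto_nhdsLT hG hst hfree)

/-- Confined trajectories have left limits everywhere. [folklore] -/
theorem tendsto_leftLim [T2Space X] (h : IsConfinedHardSphereTrajectory G W ε N γ)
    (hG : ∀ x : X, Continuous (G.translate x)) (t : ℝ) : Tendsto γ (𝓝[<] t) (𝓝 (leftLim γ t)) := by
  obtain ⟨s, hst, hfree⟩ := h.exists_Ioo_left_free t
  rw [h.leftLim_eq_freeFlight hG hst hfree]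
  exact h.tendsto_nhdsLT hG hst hfree

/-- Away from event times the left limit is the value. [folklore] -/
theorem leftLim_eq_of_not_mem [T2Space X] (h : IsConfinedHardSphereTrajectory G W ε N γ)
    (hG : ∀ x : X, Continuous (G.translate x)) {t : ℝ} (ht : t ∉ eventTimes G W ε γ) :
    leftLim γ t = γ t := by
  obtain ⟨s, hst, hfree⟩ := h.exists_Ioo_left_free t
  rw [h.leftLim_eq_freeFlight hG hst hfree]
  refine (h.free s t hst.le fun σ hσ => ?_).symm
  rcases hσ.2.eq_or_lt with rfl | hlt
  · exact ht
  · exact hfree σ ⟨hσ.1, hlt⟩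

/-- Positions do not jump: the left limit has the same positions as the value. [folklore] -/
theorem leftLim_apply_fst [T2Space X] (h : IsConfinedHardSphereTrajectory G W ε N γ)
    (hG : ∀ x : X, Continuous (G.translate x)) (t : ℝ) (i : Fin N) : (leftLim γ t i).1 = (γ t i).1 := by
  have hev : Continuous fun z : Config N d X => (z i).1 := by fun_prop
  have h1 : Tendsto (fun τ => (γ τ i).1) (𝓝[<] t) (𝓝 (leftLim γ t i).1) :=
    (hev.tendsto _).comp (h.tendsto_leftLim hG t)
  have h2 : Tendsto (fun τ => (γ τ i).1) (𝓝[<] t) (𝓝 (γ t i).1) :=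
    ((h.pos_continuous i).tendsto t).mono_left nhdsWithin_le_nhds
  exact tendsto_nhds_unique h1 h2

/-- Left limits stay in the confined domain. [folklore] -/
theorem leftLim_mem [T2Space X] (h : IsConfinedHardSphereTrajectory G W ε N γ)
    (hG : ∀ x : X, Continuous (G.translate x)) (t : ℝ) : leftLim γ t ∈ confinedDomain G W N ε :=
  (mem_confinedDomain_congr_fst (h.leftLim_apply_fst hG t)).2 (h.mem t)

/-- At a pair-collision time the left limit is incoming for the colliding pair and the value is
its elastic reflection. [folklore] -/
theorem eq_collidePair_leftLim [T2Space X] (h : IsConfinedHardSphereTrajectory G W ε N γ) {t : ℝ}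
    {i j : Fin N} (hij : i ≠ j) (hc : γ t ∈ contactSet G N ε i j) :
    IsIncoming G (leftLim γ t) i j ∧ γ t = collidePair G i j (leftLim γ t) := by
  obtain ⟨-, -, zl, hzl, hin, heq⟩ := h.binary t i j hij hc
  rw [leftLim_eq_of_tendsto hzl]
  exact ⟨hin, heq⟩

/-- At a wall-collision time the left limit is wall-incoming for the touching sphere and the
value is its specular reflection. [folklore] -/
theorem eq_reflectWall_leftLim [T2Space X] (h : IsConfinedHardSphereTrajectory G W ε N γ) {t : ℝ}
    {i : Fin N} {k : ι} (hc : (γ t i).1 ∈ (W k).contact) :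
    IsWallIncoming (W k) (leftLim γ t) i ∧ γ t = reflectWall (W k) i (leftLim γ t) := by
  obtain ⟨-, -, zl, hzl, hin, heq⟩ := h.wall t i k hc
  rw [leftLim_eq_of_tendsto hzl]
  exact ⟨hin, heq⟩

/-- Confined trajectories are right-continuous. [folklore] -/
theorem tendsto_nhdsGT (h : IsConfinedHardSphereTrajectory G W ε N γ) (hG : ∀ x : X, Continuous (G.translate x))
    (t : ℝ) : Tendsto γ (𝓝[>] t) (𝓝 (γ t)) := by
  obtain ⟨u, htu, hfree⟩ := h.exists_Ioo_right_free t
  have hc : Continuous fun τ : ℝ => freeFlight G (τ - t) (γ t) := by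
    have hff := continuous_freeFlight_of_continuous_translate hG (γ t)
    fun_prop
  have h1 : Tendsto (fun τ : ℝ => freeFlight G (τ - t) (γ t)) (𝓝[>] t) (𝓝 (γ t)) := by
    have := (hc.tendsto t).mono_left (nhdsWithin_le_nhds (s := Ioi t))
    simpa using this
  refine h1.congr' ?_
  filter_upwards [Ioo_mem_nhdsGT htu] with τ hτ
  exact (h.eq_freeFlight_of_Ioo_free hfree ⟨hτ.1.le, hτ.2⟩).symm

/-- The left-limit function has right limits equal to the trajectory. [folklore] -/
theorem tendsto_leftLim_nhdsGT [T2Space X] (h : IsConfinedHardSphereTrajectory G W ε N γ)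
    (hG : ∀ x : X, Continuous (G.translate x)) (t : ℝ) : Tendsto (leftLim γ) (𝓝[>] t) (𝓝 (γ t)) := by
  obtain ⟨u, htu, hfree⟩ := h.exists_Ioo_right_free t
  have hc : Continuous fun τ : ℝ => freeFlight G (τ - t) (γ t) := by
    have hff := continuous_freeFlight_of_continuous_translate hG (γ t)
    fun_prop
  have h1 : Tendsto (fun τ : ℝ => freeFlight G (τ - t) (γ t)) (𝓝[>] t) (𝓝 (γ t)) := by
    have := (hc.tendsto t).mono_left (nhdsWithin_le_nhds (s := Ioi t))
    simpa using this
  refine h1.congr' ?_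
  filter_upwards [Ioo_mem_nhdsGT htu] with w hw
  exact (h.leftLim_eq_freeFlight hG hw.1 fun σ hσ => hfree σ ⟨hσ.1, hσ.2.trans hw.2⟩).symm

/-- The left-limit function is left-continuous. [folklore] -/
theorem tendsto_leftLim_nhdsLT [T2Space X] (h : IsConfinedHardSphereTrajectory G W ε N γ)
    (hG : ∀ x : X, Continuous (G.translate x)) (t : ℝ) :
    Tendsto (leftLim γ) (𝓝[<] t) (𝓝 (leftLim γ t)) := by
  obtain ⟨s, hst, hfree⟩ := h.exists_Ioo_left_free t
  rw [h.leftLim_eq_freeFlight hG hst hfree]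
  have hc : Continuous fun τ : ℝ => freeFlight G (τ - s) (γ s) := by
    have hff := continuous_freeFlight_of_continuous_translate hG (γ s)
    fun_prop
  refine ((hc.tendsto t).mono_left nhdsWithin_le_nhds).congr' ?_
  filter_upwards [Ioo_mem_nhdsLT hst] with w hw
  exact (h.leftLim_eq_freeFlight hG hw.1 fun σ hσ => hfree σ ⟨hσ.1, hσ.2.trans hw.2⟩).symm

/-- At a pair-collision time the value is outgoing for every contact pair. [folklore] -/
theorem isOutgoing_of_mem_contactSet [T2Space X] (h : IsConfinedHardSphereTrajectory G W ε N γ)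
    {t : ℝ} {i j : Fin N} (hij : i ≠ j) (hc : γ t ∈ contactSet G N ε i j) : IsOutgoing G (γ t) i j := by
  obtain ⟨hin, hval⟩ := h.eq_collidePair_leftLim hij hc
  rw [hval]
  exact (isOutgoing_collidePair_iff hij _).2 hin

/-- At a wall-collision time the value is wall-outgoing for the touching sphere. [folklore] -/
theorem isWallOutgoing_of_mem_contact [T2Space X] (h : IsConfinedHardSphereTrajectory G W ε N γ)
    {t : ℝ} {i : Fin N} {k : ι} (hc : (γ t i).1 ∈ (W k).contact) : IsWallOutgoing (W k) (γ t) i := by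
  obtain ⟨hin, hval⟩ := h.eq_reflectWall_leftLim hc
  rw [hval]
  exact (isWallOutgoing_reflectWall_iff (W k) i _).2 hin

/-! ## Time shifts -/

/-- Confined trajectories are invariant under time shifts. [folklore] -/
theorem comp_add_right (h : IsConfinedHardSphereTrajectory G W ε N γ) (c : ℝ) :
    IsConfinedHardSphereTrajectory G W ε N fun t => γ (t + c) := by
  have hshift : ∀ σ, σ ∈ eventTimes G W ε (fun t => γ (t + c)) ↔ σ + c ∈ eventTimes G W ε γ :=
    fun σ => Iff.rfl
  refine ⟨fun t => h.mem _, fun a b => ?_, fun i => ?_, fun s t hst hfree => ?_,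
    fun t i j hij hc => ?_, fun t i k hc => ?_⟩
  · refine ((h.locFinite (a + c) (b + c)).image fun t => t - c).subset ?_
    rintro t ⟨ht, hta, htb⟩
    exact ⟨t + c, ⟨ht, by linarith, by linarith⟩, by ring⟩
  · exact (h.pos_continuous i).comp (continuous_add_const c)
  · show γ (t + c) = freeFlight G (t - s) (γ (s + c))
    have hf := h.free (s + c) (t + c) (by linarith) fun σ hσ => ?_
    · rw [hf]
      congr 1
      ring
    · have hσ' := hfree (σ - c) ⟨by linarith [hσ.1], by linarith [hσ.2]⟩
      rw [hshift, sub_add_cancel] at hσ'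
      exact hσ'
  · obtain ⟨huniq, hnow, zl, hzl, hin, hval⟩ := h.binary (t + c) i j hij hc
    refine ⟨huniq, hnow, zl, ?_, hin, hval⟩
    have htr : Tendsto (fun s : ℝ => s + c) (𝓝[<] t) (𝓝[<] (t + c)) :=
      (continuous_add_const c).continuousWithinAt.tendsto_nhdsWithin fun s hs => by
        have hs' : s < t := hs
        show s + c < t + c
        linarith
    exact hzl.comp htr
  · obtain ⟨huniq, hnop, zl, hzl, hin, hval⟩ := h.wall (t + c) i k hc
    refine ⟨huniq, hnop, zl, ?_, hin, hval⟩
    have htr : Tendsto (fun s : ℝ => s + c) (𝓝[<] t) (𝓝[<] (t + c)) :=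
      (continuous_add_const c).continuousWithinAt.tendsto_nhdsWithin fun s hs => by
        have hs' : s < t := hs
        show s + c < t + c
        linarith
    exact hzl.comp htr

/-! ## Time reversal -/

/-- The positions of the time reversal at `t` are those of the trajectory at `-t`. [folklore] -/
theorem timeReverse_apply_fst [T2Space X] (h : IsConfinedHardSphereTrajectory G W ε N γ)
    (hG : ∀ x : X, Continuous (G.translate x)) (t : ℝ) (i : Fin N) :
    (FluidPDE.timeReverse γ t i).1 = (γ (-t) i).1 := by
  rw [timeReverse_apply, flipVel_apply]
  exact h.leftLim_apply_fst hG (-t) i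

/-- The event times of the time reversal are the negatives of the event times. [folklore] -/
theorem mem_eventTimes_timeReverse [T2Space X] (h : IsConfinedHardSphereTrajectory G W ε N γ)
    (hG : ∀ x : X, Continuous (G.translate x)) {t : ℝ} :
    t ∈ eventTimes G W ε (FluidPDE.timeReverse γ) ↔ -t ∈ eventTimes G W ε γ := by
  have hpos : ∀ i, (FluidPDE.timeReverse γ t i).1 = ((fun s => γ (-s)) t i).1 := h.timeReverse_apply_fst hG t
  rw [mem_eventTimes_congr_fst (γ' := fun s => γ (-s)) hpos]
  rfl

/-- The left limits of the time reversal are the flipped values: `(Rγ)(u⁻) = S (γ (-u))`. [folklore] -/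
theorem leftLim_timeReverse [T2Space X] (h : IsConfinedHardSphereTrajectory G W ε N γ)
    (hG : ∀ x : X, Continuous (G.translate x)) (u : ℝ) :
    leftLim (FluidPDE.timeReverse γ) u = flipVel (γ (-u)) := by
  refine leftLim_eq_of_tendsto ?_
  have h1 : Tendsto (fun w : ℝ => -w) (𝓝[<] u) (𝓝[>] (-u)) := tendsto_neg_nhdsLT
  have h2 := (h.tendsto_leftLim_nhdsGT hG (-u)).comp h1
  exact (continuous_flipVel.tendsto _).comp h2

/-- **Reversibility of the confined hard-sphere dynamics** (CIP 1994 §4.2, (2.3), now with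
specular walls): the time reversal `t ↦ flipVel (leftLim γ (-t))` of a confined hard-sphere
trajectory is a confined hard-sphere trajectory, for a Hausdorff position space and continuous
translations. Positions, hence contacts of both kinds, are read off `γ (-t)`; on a reversed
event-free stretch the left limits are free-flight values and `S_u ∘ S ∘ S_u = S`; at a reversed
event time the new left limit is the flip of the old post-event value, incoming because the old
one was outgoing, and the new value is its image because both jump maps commute with the flip
and are involutions. [cite: CIP1994, §4.2 (2.3)] -/
theorem timeReverse [T2Space X] (hG : ∀ x : X, Continuous (G.translate x))
    (h : IsConfinedHardSphereTrajectory G W ε N γ) :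
    IsConfinedHardSphereTrajectory G W ε N (FluidPDE.timeReverse γ) := by
  have hpos : ∀ t i, (FluidPDE.timeReverse γ t i).1 = (γ (-t) i).1 := h.timeReverse_apply_fst hG
  have hcol : ∀ t, t ∈ eventTimes G W ε (FluidPDE.timeReverse γ) ↔ -t ∈ eventTimes G W ε γ :=
    fun t => h.mem_eventTimes_timeReverse hG
  have hlim : ∀ t, Tendsto (FluidPDE.timeReverse γ) (𝓝[<] t) (𝓝 (flipVel (γ (-t)))) := fun t => by
    change Tendsto (fun t' => flipVel (leftLim γ (-t'))) (𝓝[<] t) (𝓝 (flipVel (γ (-t))))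
    exact (continuous_flipVel.tendsto _).comp ((h.tendsto_leftLim_nhdsGT hG (-t)).comp tendsto_neg_nhdsLT)
  refine ⟨fun t => ?_, fun a b => ?_, fun i => ?_, fun s t hst hfree => ?_, fun t i j hij hc => ?_,
    fun t i k hc => ?_⟩
  · exact (mem_confinedDomain_congr_fst (hpos t)).2 (h.mem (-t))
  · have hset : eventTimes G W ε (FluidPDE.timeReverse γ) ∩ Icc a b =
        Neg.neg ⁻¹' (eventTimes G W ε γ ∩ Icc (-b) (-a)) := by
      ext t
      simp only [mem_inter_iff, hcol t, mem_Icc, mem_preimage, neg_le_neg_iff]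
      tauto
    rw [hset]
    exact (h.locFinite (-b) (-a)).preimage neg_injective.injOn
  · have hfun : (fun t => (FluidPDE.timeReverse γ t i).1) = fun t => (γ (-t) i).1 := funext fun t => hpos t i
    rw [hfun]
    simpa only [Function.comp_def] using (h.pos_continuous i).comp continuous_neg
  · rcases hst.eq_or_lt with rfl | hst'
    · simp
    have hnt : -t ∉ eventTimes G W ε γ := fun hmem => hfree t ⟨hst', le_rfl⟩ ((hcol t).2 hmem)
    have hfreeγ : ∀ σ ∈ Ioo (-t) (-s), σ ∉ eventTimes G W ε γ := fun σ hσ hmem =>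
      hfree (-σ) ⟨by linarith [hσ.2], by linarith [hσ.1]⟩ ((hcol (-σ)).2 (by simpa using hmem))
    have h1 : leftLim γ (-s) = freeFlight G (-s - -t) (γ (-t)) := h.leftLim_eq_freeFlight hG (by linarith) hfreeγ
    have h2 : leftLim γ (-t) = γ (-t) := h.leftLim_eq_of_not_mem hG hnt
    rw [timeReverse_apply, timeReverse_apply, h1, h2, show -s - -t = t - s by ring, freeFlight_flipVel_freeFlight]
  · have hcγ : γ (-t) ∈ contactSet G N ε i j := (mem_contactSet_congr_fst (hpos t)).1 hc
    obtain ⟨huniq, hnow, -⟩ := h.binary (-t) i j hij hcγ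
    obtain ⟨hin, heq⟩ := h.eq_collidePair_leftLim hij hcγ
    refine ⟨fun i' j' hij' hc' => huniq i' j' hij' ((mem_contactSet_congr_fst (hpos t)).1 hc'),
      fun i' k hc' => hnow i' k (by rw [← hpos t i']; exact hc'), flipVel (γ (-t)), hlim t, ?_, ?_⟩
    · rw [isIncoming_flipVel_iff, heq, isOutgoing_collidePair_iff hij]
      exact hin
    · rw [timeReverse_apply, collidePair_flipVel hij, heq, collidePair_collidePair hij]
  · have hcγ : (γ (-t) i).1 ∈ (W k).contact := by rw [← hpos t i]; exact hc
    obtain ⟨huniq, hnop, -⟩ := h.wall (-t) i k hcγ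
    obtain ⟨hin, heq⟩ := h.eq_reflectWall_leftLim hcγ
    refine ⟨fun i' k' hc' => huniq i' k' (by rw [← hpos t i']; exact hc'),
      fun i' j' hij' hc' => hnop i' j' hij' ((mem_contactSet_congr_fst (hpos t)).1 hc'),
      flipVel (γ (-t)), hlim t, ?_, ?_⟩
    · rw [isWallIncoming_flipVel_iff, heq, isWallOutgoing_reflectWall_iff]
      exact hin
    · rw [timeReverse_apply, reflectWall_flipVel, heq, reflectWall_reflectWall]

end IsConfinedHardSphereTrajectory

end Kinetic

end

end Literature.Analysis.FluidPDE
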